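import Summits.NavierStokesRegularity.NavierStokesRegularity.Theses.AxisymmetricExtremality
import Summits.NavierStokesRegularity.NavierStokesRegularity.Theorems.AxisymmetricExtremalityAxisymmetricKatoGlobalStubSereginLogSwirlOriginStep4AssemblyPoloidal
import Summits.NavierStokesRegularity.NavierStokesRegularity.Theorems.AxisymmetricExtremalityAxisymmetricKatoGlobalStubSereginLogSwirlOriginVThetaPassage
import Literature.Analysis.FluidPDE.CylinderTenThirds
import HarnessLib

/-!
# Seregin 2022, §2 Step 4 (assembly, II): the swirl part at a fixed time and the `L^{10/3}`
# bound of `η³Φ` from (2.7) — crux stmt-NavierStokesRegularity-15453 (`AxisymmetricExtremality.AxisymmetricKatoGlobal`), line registered, support for stub `stub_sereginLogSwirlOrigin`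

Support file (`--supports stmt-NavierStokesRegularity-15453`; theorems only, everything proved)
toward the registered stub `stub_sereginLogSwirlOrigin` = the named fact
`Literature.Analysis.FluidPDE.seregin2022_logSwirl_regularAtOrigin` (G. Seregin, J. Math. Fluid
Mech. 24 (2022), Paper 27 = arXiv:2201.00153, §2).  Second file of the Step-4 assembly
("Step-3 bounds ⇒ `C(R) → 0`", arXiv p. 7; first file `…Step4AssemblyPoloidal.lean`).  The swirl
component is handled in print by "`η³v_θ(r,x₃,t) = ∫_{-1}^{x₃}(η³v_θ),₃ dy` … `sup (1/r)|η³v_θ| ≤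
c(∫(|Φη³| + |(η³),₃||v_θ|/r)^{10/3}dy)^{3/10}` … `∫_{Q(R)}|v_θ|^{10/3} ≤ cR^{10/3+1}[…]`", with
"boundedness of `|∇v|` in the support of `∇η`" and the finiteness of `‖Φη³‖_{10/3,Q}` coming from
(2.7) `|η³Φ|²_{2,Q} < ∞`.  With `ζ` for `η³`, `Φ = radVelQuot (curl u) = ω_r/r`, and the landed
`x₃`-Poincaré inequality `lintegral_spaceCyl_mul_swirlVelocity_rpow_le` (`…VThetaPassage.lean`):

* `radialVelocity_curl_eq_cylRadius_mul_radVelQuot` — `ω_r = rΦ` everywhere;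
* `enorm_poincareIntegrand_le` — near the axis `|ζω_r| + |∂₃ζ · u_θ| ≤ R|ζΦ| + C_ζL` when
  `|u| ≤ L` on `supp Dζ` (the collar term: `|u_θ| ≤ |u|`);
* `volume_tallCyl_le` — `|{|x'| < R, |x₃| < 1}| ≤ 2|B₁(ℝ²)|R²`;
* `setLIntegral_spaceCyl_enorm_swirlVelocity_rpow_le` (registered; hypothesis form `…_le'`) —
  **`∫_{𝒞(R)} |u_θ|^p ≤ 2^pR · 2^{p-1}(R^p∫|ζΦ|^p + (C_ζL)^p · 2|B₁(ℝ²)|R²)`**, the printed gain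
  `R^{p+1}`;
* `norm_fderiv_mul_sq_le`, `lintegral_enorm_fderiv_mul_radVelQuot_sq_le` — the rewriting of the
  Step-3 output "to the form (2.7)": `∫‖D(ζΦ)‖² ≤ 2∫ζ²(‖DΦ‖² + ‖DΓ‖²) + 2C_ζ²L²|𝒞|` when
  `|Φ| ≤ L` on `supp Dζ`;
* `lintegral_enorm_rpow_tenThirds_le_of_contDiff` — `∫|g|^{10/3} ≤ (∫g²)^{2/3} C_S² ∫‖Dg‖²`;
* `lintegral_lintegral_enorm_mul_rpow_tenThirds_le` (registered; hypothesis form `…_le'`) —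
  **`∫_{t₁}^0∫|ζΦ|^{10/3} ≤ K^{2/3} C_S² K'`** from `sup_t ∫(ζΦ)² ≤ K`, `∫_{t₁}^0∫‖D(ζΦ)‖² ≤ K'`.

## References

* G. Seregin, J. Math. Fluid Mech. 24 (2022), Paper No. 27 = arXiv:2201.00153, §2 Step 4 (arXiv
  p. 7: (2.7) and the `v_θ` passage), Step 3 (`Φ = ω_r/r`, arXiv p. 6). [`Seregin2022LocalAxisym`]
-/

noncomputable section

open Set MeasureTheory Filter Topology Function Metric
open scoped ENNReal NNReal RealInnerProductSpace
open Literature.Analysis.FluidPDE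

-- `<Problem> = <Summit>` duplicates a namespace component by design (lakefile sets the same option).
set_option linter.dupNamespace false

namespace Summit.NavierStokesRegularity.NavierStokesRegularity.Theorems.AxisymmetricKatoGlobal.EulerScaling

/-! ### The swirl part at a fixed time: `ω_r = rΦ`, the collar term, the `x₃`-Poincaré bound -/

section SwirlSlice

variable {u : EuclideanSpace ℝ (Fin 3) → EuclideanSpace ℝ (Fin 3)} {ζ : EuclideanSpace ℝ (Fin 3) → ℝ}
  {K : ℝ≥0} {Cζ L : ℝ}

/-- **`ω_r = rΦ` everywhere** for an axisymmetric `u ∈ C³` (`Φ = radVelQuot (curl u)`: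
`r²Φ = x₀ω₀ + x₁ω₁ = rω_r`, and both sides vanish on the axis). [cite: Seregin2022LocalAxisym, §2 Step 3 (arXiv:2201.00153 p. 6), `Φ = ω_r/r`] -/
theorem radialVelocity_curl_eq_cylRadius_mul_radVelQuot (hax : IsAxisymmetric u)
    (hu : ContDiff ℝ 3 u) (x : EuclideanSpace ℝ (Fin 3)) :
    radialVelocity (curl u) x = cylRadius x * radVelQuot (curl u) x := by
  have hud : Differentiable ℝ u := hu.differentiable (by norm_num)
  have hω2 : ContDiff ℝ 2 (curl u) := contDiff_curl_of_succ (n := 2) (by exact_mod_cast hu)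
  have h := (hax.curl hud).cylRadius_sq_mul_radVelQuot hω2 x
  rw [SereginZajaczkowski2007.radialVelocity_eq_div, ← h]
  rcases eq_or_ne (cylRadius x) 0 with h0 | h0
  · rw [h0]; simp
  · field_simp

/-- A cut-off supported in the unit cylinder `𝒞` vanishes where `x₃ ≤ -1`. [folklore] -/
theorem eq_zero_of_apply_two_le_neg_one (hζ1 : tsupport ζ ⊆ SereginSverak2009.spaceCyl 0 1)
    (y : EuclideanSpace ℝ (Fin 3)) (hy : y 2 ≤ -1) : ζ y = 0 := by
  refine image_eq_zero_of_notMem_tsupport fun h => ?_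
  have h2 := ((SereginSverak2009.mem_spaceCyl).1 (hζ1 h)).2
  simp only [PiLp.zero_apply, sub_zero] at h2
  linarith [(abs_lt.1 h2).1]

/-- **The integrand of the `v_θ` passage near the axis** (Seregin: "`|Φη³| + |(η³),₃||v_θ|/r`",
with "boundedness of … in the support of `∇η`"): at a point with `|x'| < R`, for an axisymmetric
`u ∈ C³` bounded by `L` on `supp Dζ`, `‖Dζ‖ ≤ C_ζ`:
`|ζω_r| + |∂₃ζ · u_θ| ≤ R|ζΦ| + C_ζ L`. [cite: Seregin2022LocalAxisym, §2 Step 4 (arXiv:2201.00153 p. 7), the `v_θ` passage] -/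
theorem enorm_poincareIntegrand_le (hax : IsAxisymmetric u) (hu : ContDiff ℝ 3 u)
    (hCζ : ∀ x, ‖fderiv ℝ ζ x‖ ≤ Cζ) (hL : ∀ x, fderiv ℝ ζ x ≠ 0 → ‖u x‖ ≤ L)
    {R : ℝ} {x : EuclideanSpace ℝ (Fin 3)} (hx : cylRadius x < R) :
    ‖ζ x * radialVelocity (curl u) x‖ₑ +
        ‖fderiv ℝ ζ x (EuclideanSpace.single 2 1) * swirlVelocity u x‖ₑ ≤
      ENNReal.ofReal R * ‖ζ x * radVelQuot (curl u) x‖ₑ + ENNReal.ofReal Cζ * ENNReal.ofReal L := by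
  refine add_le_add ?_ ?_
  · rw [radialVelocity_curl_eq_cylRadius_mul_radVelQuot hax hu x,
      show ζ x * (cylRadius x * radVelQuot (curl u) x) =
        cylRadius x * (ζ x * radVelQuot (curl u) x) by ring, enorm_mul, Real.enorm_eq_ofReal_abs,
      abs_of_nonneg (cylRadius_nonneg x)]
    exact mul_le_mul' (ENNReal.ofReal_le_ofReal hx.le) le_rfl
  · by_cases hD : fderiv ℝ ζ x = 0
    · rw [hD]; simp
    · have hLx := hL x hD
      have h1 : |fderiv ℝ ζ x (EuclideanSpace.single 2 1)| ≤ Cζ := by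
        have h := (fderiv ℝ ζ x).le_opNorm (EuclideanSpace.single 2 (1 : ℝ))
        have hn : ‖EuclideanSpace.single (2 : Fin 3) (1 : ℝ)‖ = 1 := by simp
        rw [hn, mul_one, Real.norm_eq_abs] at h
        exact h.trans (hCζ x)
      have h2 : |swirlVelocity u x| ≤ L := (abs_swirlVelocity_le u x).trans hLx
      rw [enorm_mul, Real.enorm_eq_ofReal_abs, Real.enorm_eq_ofReal_abs]
      exact mul_le_mul' (ENNReal.ofReal_le_ofReal h1) (ENNReal.ofReal_le_ofReal h2)

/-- `|{|x'| < R, |x₃| < 1}| ≤ 2|B₁(ℝ²)| R²` (Tonelli through `cylSplit`). [folklore] -/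
theorem volume_tallCyl_le {R : ℝ} (hR : 0 ≤ R) :
    volume {x : EuclideanSpace ℝ (Fin 3) | cylRadius x < R ∧ |x 2| < 1} ≤
      2 * volume (ball (0 : EuclideanSpace ℝ (Fin 2)) 1) * ENNReal.ofReal R ^ (2 : ℝ) := by
  have hset : {x : EuclideanSpace ℝ (Fin 3) | cylRadius x < R ∧ |x 2| < 1} =
      {x : EuclideanSpace ℝ (Fin 3) | cylRadius x < R ∧ x 2 ∈ Ioo (-1 : ℝ) 1} := by
    ext x; simp [abs_lt, mem_Ioo]
  have h := setLIntegral_cyl_eq_lintegral_lintegral (G := fun _ => (1 : ℝ≥0∞)) aemeasurable_const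
    R (Ioo (-1 : ℝ) 1)
  simp only [lintegral_const, Measure.restrict_apply_univ, one_mul, Real.volume_Ioo] at h
  rw [hset, h, show (1 : ℝ) - -1 = 2 by norm_num, ENNReal.ofReal_ofNat,
    Measure.addHaar_ball volume (0 : EuclideanSpace ℝ (Fin 2)) hR, finrank_euclideanSpace_fin,
    ENNReal.ofReal_pow hR]
  have e2 : ENNReal.ofReal R ^ (2 : ℝ) = ENNReal.ofReal R ^ (2 : ℕ) := by
    rw [show (2 : ℝ) = ((2 : ℕ) : ℝ) by norm_num, ENNReal.rpow_natCast]
  rw [e2]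
  exact le_of_eq (by ring)

/-- **The `v_θ` slice bound** (Seregin: "`∫_{Q(R)}|v_θ|^{10/3} ≤ ∫∫ (R^{10/3}∫|v_θ/r|^{10/3}dx₃) r dr dt
≤ cR^{10/3+1}[…]`", at a fixed time): for an axisymmetric `u ∈ C³` bounded by `L` on `supp Dζ`,
`ζ ∈ C¹` with `tsupport ζ ⊆ 𝒞`, `‖Dζ‖ ≤ C_ζ`, `ζ = 1` on `𝒞(R)`, `0 < R ≤ 1`, `p ≥ 1`:
`∫_{𝒞(R)} |u_θ|^p ≤ 2^p R · 2^{p-1} (R^p ∫ |ζΦ|^p + (C_ζ L)^p · 2|B₁(ℝ²)|R²)`.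
[cite: Seregin2022LocalAxisym, §2 Step 4 (arXiv:2201.00153 p. 7), the `v_θ` passage] -/
theorem setLIntegral_spaceCyl_enorm_swirlVelocity_rpow_le' (hax : IsAxisymmetric u)
    (hu : ContDiff ℝ 3 u) (hζ : ContDiff ℝ 1 ζ) (hζ1 : tsupport ζ ⊆ SereginSverak2009.spaceCyl 0 1)
    (hCζ : ∀ x, ‖fderiv ℝ ζ x‖ ≤ Cζ) (hL : ∀ x, fderiv ℝ ζ x ≠ 0 → ‖u x‖ ≤ L)
    {p : ℝ} (hp : 1 ≤ p) {R : ℝ} (hR : 0 < R) (hR1 : R ≤ 1)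
    (hζR : ∀ x ∈ SereginSverak2009.spaceCyl 0 R, ζ x = 1) :
    ∫⁻ x in SereginSverak2009.spaceCyl 0 R, ‖swirlVelocity u x‖ₑ ^ p ≤
      2 ^ p * ENNReal.ofReal R * (2 ^ (p - 1) *
        (ENNReal.ofReal R ^ p * (∫⁻ x, ‖ζ x * radVelQuot (curl u) x‖ₑ ^ p) +
          (ENNReal.ofReal Cζ * ENNReal.ofReal L) ^ p *
            (2 * volume (ball (0 : EuclideanSpace ℝ (Fin 2)) 1) * ENNReal.ofReal R ^ (2 : ℝ)))) := by
  have hp0 : 0 ≤ p := zero_le_one.trans hp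
  have hPo := lintegral_spaceCyl_mul_swirlVelocity_rpow_le u ζ p R hax hζ
    (eq_zero_of_apply_two_le_neg_one hζ1) (fun y _ _ => hu.contDiffAt.of_le (by norm_num)) hp hR1
  have hL1 : ∫⁻ x in SereginSverak2009.spaceCyl 0 R, ‖swirlVelocity u x‖ₑ ^ p =
      ∫⁻ x in SereginSverak2009.spaceCyl 0 R, ‖ζ x * swirlVelocity u x‖ₑ ^ p :=
    setLIntegral_congr_fun (SereginSverak2009.isOpen_spaceCyl 0 R).measurableSet fun x hx => by
      simp only [hζR x hx, one_mul]
  rw [hL1]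
  refine hPo.trans (mul_le_mul' le_rfl ?_)
  have hSm : MeasurableSet {x : EuclideanSpace ℝ (Fin 3) | cylRadius x < R ∧ |x 2| < 1} := by
    have h2 : Continuous fun x : EuclideanSpace ℝ (Fin 3) => |x 2| :=
      continuous_abs.comp (EuclideanSpace.proj (2 : Fin 3)).continuous
    exact ((isOpen_lt continuous_cylRadius continuous_const).inter
      (isOpen_lt h2 continuous_const)).measurableSet
  set a : EuclideanSpace ℝ (Fin 3) → ℝ≥0∞ := fun x => ‖ζ x * radVelQuot (curl u) x‖ₑ with ha
  set c : ℝ≥0∞ := ENNReal.ofReal Cζ * ENNReal.ofReal L with hc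
  calc ∫⁻ x in {x : EuclideanSpace ℝ (Fin 3) | cylRadius x < R ∧ |x 2| < 1},
        (‖ζ x * radialVelocity (curl u) x‖ₑ +
          ‖fderiv ℝ ζ x (EuclideanSpace.single 2 1) * swirlVelocity u x‖ₑ) ^ p
      ≤ ∫⁻ x in {x : EuclideanSpace ℝ (Fin 3) | cylRadius x < R ∧ |x 2| < 1},
          2 ^ (p - 1) * (ENNReal.ofReal R ^ p * a x ^ p + c ^ p) := by
        refine setLIntegral_mono' hSm fun x hx => ?_
        refine (ENNReal.rpow_le_rpow (enorm_poincareIntegrand_le hax hu hCζ hL hx.1) hp0).trans ?_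
        refine (ENNReal.rpow_add_le_mul_rpow_add_rpow _ _ hp).trans (le_of_eq ?_)
        rw [ENNReal.mul_rpow_of_nonneg _ _ hp0]
    _ = 2 ^ (p - 1) * (ENNReal.ofReal R ^ p *
          (∫⁻ x in {x : EuclideanSpace ℝ (Fin 3) | cylRadius x < R ∧ |x 2| < 1}, a x ^ p) +
          c ^ p * volume {x : EuclideanSpace ℝ (Fin 3) | cylRadius x < R ∧ |x 2| < 1}) := by
        rw [lintegral_const_mul' _ _ (ENNReal.rpow_ne_top_of_nonneg (by linarith) ENNReal.ofNat_ne_top),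
          lintegral_add_right _ measurable_const,
          lintegral_const_mul' _ _ (ENNReal.rpow_ne_top_of_nonneg hp0 ENNReal.ofReal_ne_top),
          lintegral_const, Measure.restrict_apply_univ]
    _ ≤ 2 ^ (p - 1) * (ENNReal.ofReal R ^ p * (∫⁻ x, a x ^ p) +
          c ^ p * (2 * volume (ball (0 : EuclideanSpace ℝ (Fin 2)) 1) * ENNReal.ofReal R ^ (2 : ℝ))) := by
        gcongr
        · exact Measure.restrict_le_self
        · exact volume_tallCyl_le hR.le

/-- **The `v_θ` slice bound of Seregin 2022, §2 Step 4** (registered form of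
`setLIntegral_spaceCyl_enorm_swirlVelocity_rpow_le'`): for an axisymmetric `u ∈ C³(ℝ³)` with
`|u| ≤ L` on `supp Dζ`, a `C¹` cut-off `ζ` with `tsupport ζ ⊆ 𝒞`, `‖Dζ‖ ≤ C_ζ`, `ζ = 1` on `𝒞(R)`,
`0 < R ≤ 1`, `p ≥ 1`:
`∫_{𝒞(R)} |u_θ|^p ≤ 2^p R · 2^{p-1} (R^p ∫|ζΦ|^p + (C_ζL)^p · 2|B₁(ℝ²)|R²)`, `Φ = radVelQuot (curl u)`.
[cite: Seregin2022LocalAxisym, §2 Step 4 (arXiv:2201.00153 p. 7), the `v_θ` passage] -/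
theorem setLIntegral_spaceCyl_enorm_swirlVelocity_rpow_le : ∀ (u : EuclideanSpace ℝ (Fin 3) → EuclideanSpace ℝ (Fin 3)) (ζ : EuclideanSpace ℝ (Fin 3) → ℝ) (Cζ L p R : ℝ), IsAxisymmetric u → ContDiff ℝ 3 u → ContDiff ℝ 1 ζ → tsupport ζ ⊆ SereginSverak2009.spaceCyl 0 1 → (∀ x, ‖fderiv ℝ ζ x‖ ≤ Cζ) → (∀ x, fderiv ℝ ζ x ≠ 0 → ‖u x‖ ≤ L) → 1 ≤ p → 0 < R → R ≤ 1 → (∀ x ∈ SereginSverak2009.spaceCyl 0 R, ζ x = 1) → ∫⁻ x in SereginSverak2009.spaceCyl 0 R, ‖swirlVelocity u x‖ₑ ^ p ≤ 2 ^ p * ENNReal.ofReal R * (2 ^ (p - 1) * (ENNReal.ofReal R ^ p * (∫⁻ x, ‖ζ x * radVelQuot (curl u) x‖ₑ ^ p) + (ENNReal.ofReal Cζ * ENNReal.ofReal L) ^ p * (2 * volume (ball (0 : EuclideanSpace ℝ (Fin 2)) 1) * ENNReal.ofReal R ^ (2 : ℝ)))) :=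
  fun _ _ _ _ _ _ hax hu hζ hζ1 hCζ hL hp hR hR1 hζR =>
    setLIntegral_spaceCyl_enorm_swirlVelocity_rpow_le' hax hu hζ hζ1 hCζ hL hp hR hR1 hζR

end SwirlSlice

/-! ### `(2.7)` for `Φ`: the `L^{10/3}` bound of `ζΦ` from the Step-3 bounds -/

section Phi

variable {u : EuclideanSpace ℝ (Fin 3) → EuclideanSpace ℝ (Fin 3)} {ζ : EuclideanSpace ℝ (Fin 3) → ℝ}
  {K : ℝ≥0} {Cζ L : ℝ}

/-- `‖D(ζΦ)‖² ≤ 2ζ²‖DΦ‖² + 2‖Dζ‖²Φ²` pointwise. [folklore] -/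
theorem norm_fderiv_mul_sq_le {Φ : EuclideanSpace ℝ (Fin 3) → ℝ} {x : EuclideanSpace ℝ (Fin 3)}
    (hζ : DifferentiableAt ℝ ζ x) (hΦ : DifferentiableAt ℝ Φ x) :
    ‖fderiv ℝ (fun y => ζ y * Φ y) x‖ ^ 2 ≤
      2 * (ζ x ^ 2 * ‖fderiv ℝ Φ x‖ ^ 2) + 2 * (‖fderiv ℝ ζ x‖ ^ 2 * Φ x ^ 2) := by
  rw [fderiv_fun_mul hζ hΦ]
  have h := norm_add_le (ζ x • fderiv ℝ Φ x) (Φ x • fderiv ℝ ζ x)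
  rw [norm_smul, norm_smul, Real.norm_eq_abs, Real.norm_eq_abs] at h
  have h0 : 0 ≤ ‖ζ x • fderiv ℝ Φ x + Φ x • fderiv ℝ ζ x‖ := norm_nonneg _
  calc ‖ζ x • fderiv ℝ Φ x + Φ x • fderiv ℝ ζ x‖ ^ 2
      ≤ (|ζ x| * ‖fderiv ℝ Φ x‖ + |Φ x| * ‖fderiv ℝ ζ x‖) ^ 2 := pow_le_pow_left₀ h0 h 2
    _ ≤ 2 * (|ζ x| * ‖fderiv ℝ Φ x‖) ^ 2 + 2 * (|Φ x| * ‖fderiv ℝ ζ x‖) ^ 2 := by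
        nlinarith [sq_nonneg (|ζ x| * ‖fderiv ℝ Φ x‖ - |Φ x| * ‖fderiv ℝ ζ x‖)]
    _ = _ := by rw [mul_pow, mul_pow, sq_abs, sq_abs]; ring

/-- **From the Step-3 output to (2.7), at a fixed time** (Seregin: "It can be re-written to the form
(2.7): `|η³Φ|²_{2,Q} + |η³Γ|²_{2,Q} < ∞`", the commutator term by "boundedness of `|∇ω|`" on
`supp ∇η`): for `u ∈ C⁴`, `ζ ∈ C¹` with `tsupport ζ ⊆ 𝒞`, `‖Dζ‖ ≤ C_ζ`, `|Φ| ≤ L` on `supp Dζ`: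
`∫ ‖D(ζΦ)‖² ≤ 2∫ ζ²(‖DΦ‖² + ‖DΓ‖²) + 2C_ζ²L²|𝒞|`. [cite: Seregin2022LocalAxisym, §2 Step 4 (arXiv:2201.00153 p. 7), (2.7)] -/
theorem lintegral_enorm_fderiv_mul_radVelQuot_sq_le (hu : ContDiff ℝ 4 u) (hζ : ContDiff ℝ 1 ζ)
    (hζ1 : tsupport ζ ⊆ SereginSverak2009.spaceCyl 0 1) (hCζ : ∀ x, ‖fderiv ℝ ζ x‖ ≤ Cζ)
    (hLΦ : ∀ x, fderiv ℝ ζ x ≠ 0 → |radVelQuot (curl u) x| ≤ L) :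
    ∫⁻ x, ‖fderiv ℝ (fun y => ζ y * radVelQuot (curl u) y) x‖ₑ ^ 2 ≤
      2 * (∫⁻ x, ENNReal.ofReal (ζ x ^ 2 * (‖fderiv ℝ (radVelQuot (curl u)) x‖ ^ 2 +
        ‖fderiv ℝ (angVortQuot u) x‖ ^ 2))) +
      ENNReal.ofReal (2 * Cζ ^ 2 * L ^ 2) *
        volume (SereginSverak2009.spaceCyl (0 : EuclideanSpace ℝ (Fin 3)) 1) := by
  have hω3 : ContDiff ℝ 3 (curl u) := contDiff_curl_of_succ (n := 3) (by exact_mod_cast hu)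
  have hΦ1 : ContDiff ℝ 1 (radVelQuot (curl u)) := contDiff_radVelQuot (n := 1) (by exact_mod_cast hω3)
  have hζd : Differentiable ℝ ζ := hζ.differentiable one_ne_zero
  have hΦd : Differentiable ℝ (radVelQuot (curl u)) := hΦ1.differentiable one_ne_zero
  have hpt : ∀ x, ‖fderiv ℝ (fun y => ζ y * radVelQuot (curl u) y) x‖ₑ ^ 2 ≤
      2 * ENNReal.ofReal (ζ x ^ 2 * (‖fderiv ℝ (radVelQuot (curl u)) x‖ ^ 2 +
        ‖fderiv ℝ (angVortQuot u) x‖ ^ 2)) +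
        ENNReal.ofReal (2 * (‖fderiv ℝ ζ x‖ ^ 2 * radVelQuot (curl u) x ^ 2)) := by
    intro x
    have e : (2 : ℝ≥0∞) * ENNReal.ofReal (ζ x ^ 2 * (‖fderiv ℝ (radVelQuot (curl u)) x‖ ^ 2 +
        ‖fderiv ℝ (angVortQuot u) x‖ ^ 2)) +
        ENNReal.ofReal (2 * (‖fderiv ℝ ζ x‖ ^ 2 * radVelQuot (curl u) x ^ 2)) =
        ENNReal.ofReal (2 * (ζ x ^ 2 * (‖fderiv ℝ (radVelQuot (curl u)) x‖ ^ 2 +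
          ‖fderiv ℝ (angVortQuot u) x‖ ^ 2)) + 2 * (‖fderiv ℝ ζ x‖ ^ 2 * radVelQuot (curl u) x ^ 2)) := by
      rw [ENNReal.ofReal_add (by positivity) (by positivity), ENNReal.ofReal_mul zero_le_two,
        ENNReal.ofReal_mul zero_le_two, ENNReal.ofReal_ofNat]
    rw [e, ← ofReal_norm, ← ENNReal.ofReal_pow (norm_nonneg _)]
    refine ENNReal.ofReal_le_ofReal ((norm_fderiv_mul_sq_le (hζd x) (hΦd x)).trans ?_)
    nlinarith [mul_nonneg (sq_nonneg (ζ x)) (sq_nonneg ‖fderiv ℝ (angVortQuot u) x‖)]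
  have hm : Measurable fun x => 2 * ENNReal.ofReal (ζ x ^ 2 *
      (‖fderiv ℝ (radVelQuot (curl u)) x‖ ^ 2 + ‖fderiv ℝ (angVortQuot u) x‖ ^ 2)) := by
    refine Measurable.const_mul (Measurable.ennreal_ofReal ?_) _
    exact (hζ.continuous.pow 2).measurable.mul
      (((measurable_fderiv ℝ (radVelQuot (curl u))).norm.pow_const 2).add
        ((measurable_fderiv ℝ (angVortQuot u)).norm.pow_const 2))
  calc ∫⁻ x, ‖fderiv ℝ (fun y => ζ y * radVelQuot (curl u) y) x‖ₑ ^ 2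
      ≤ ∫⁻ x, (2 * ENNReal.ofReal (ζ x ^ 2 * (‖fderiv ℝ (radVelQuot (curl u)) x‖ ^ 2 +
          ‖fderiv ℝ (angVortQuot u) x‖ ^ 2)) +
          ENNReal.ofReal (2 * (‖fderiv ℝ ζ x‖ ^ 2 * radVelQuot (curl u) x ^ 2))) :=
        lintegral_mono hpt
    _ = 2 * (∫⁻ x, ENNReal.ofReal (ζ x ^ 2 * (‖fderiv ℝ (radVelQuot (curl u)) x‖ ^ 2 +
          ‖fderiv ℝ (angVortQuot u) x‖ ^ 2))) +
          ∫⁻ x, ENNReal.ofReal (2 * (‖fderiv ℝ ζ x‖ ^ 2 * radVelQuot (curl u) x ^ 2)) := by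
        rw [lintegral_add_left hm, lintegral_const_mul' _ _ ENNReal.ofNat_ne_top]
    _ ≤ _ := by
        gcongr
        calc ∫⁻ x, ENNReal.ofReal (2 * (‖fderiv ℝ ζ x‖ ^ 2 * radVelQuot (curl u) x ^ 2))
            ≤ ∫⁻ x in SereginSverak2009.spaceCyl (0 : EuclideanSpace ℝ (Fin 3)) 1,
                ENNReal.ofReal (2 * Cζ ^ 2 * L ^ 2) := by
              refine lintegral_le_setLIntegral_of_forall_notMem
                (SereginSverak2009.isOpen_spaceCyl 0 1).measurableSet (fun x hx => ?_)
                (fun x _ => ENNReal.ofReal_le_ofReal ?_)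
              · have hx' : x ∉ tsupport ζ := fun h => hx (hζ1 h)
                rw [fderiv_of_notMem_tsupport ℝ hx', norm_zero]; simp
              · by_cases hD : fderiv ℝ ζ x = 0
                · rw [hD, norm_zero]
                  nlinarith [mul_nonneg (sq_nonneg Cζ) (sq_nonneg L)]
                · have h1 : ‖fderiv ℝ ζ x‖ ^ 2 ≤ Cζ ^ 2 := pow_le_pow_left₀ (norm_nonneg _) (hCζ x) 2
                  have h2 : radVelQuot (curl u) x ^ 2 ≤ L ^ 2 := by
                    rw [← sq_abs (radVelQuot (curl u) x)]
                    exact pow_le_pow_left₀ (abs_nonneg _) (hLΦ x hD) 2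
                  nlinarith [mul_le_mul h1 h2 (sq_nonneg _) (sq_nonneg Cζ)]
          _ = _ := by rw [setLIntegral_const]

/-- **`L^{10/3}` interpolation for a `C¹_c` scalar** (Seregin: the norm `‖Φη³‖_{10/3,Q}`, from
`|η³Φ|_{2,Q} < ∞`): `∫ |g|^{10/3} ≤ (∫ g²)^{2/3} · C_S² ∫ ‖Dg‖²` (Lebesgue interpolation between `L²`
and `L⁶`, then GNS). [cite: Seregin2022LocalAxisym, §2 Step 4 (arXiv:2201.00153 p. 7)] -/
theorem lintegral_enorm_rpow_tenThirds_le_of_contDiff {g : EuclideanSpace ℝ (Fin 3) → ℝ}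
    (hg : ContDiff ℝ 1 g) (hgc : HasCompactSupport g) :
    ∫⁻ x, ‖g x‖ₑ ^ (10 / 3 : ℝ) ≤ (∫⁻ x, ‖g x‖ₑ ^ 2) ^ (2 / 3 : ℝ) *
      ((eLpNormLESNormFDerivOfEqInnerConst (volume : Measure (EuclideanSpace ℝ (Fin 3))) 2 : ℝ≥0∞)
          ^ (2 : ℝ) * ∫⁻ x, ‖fderiv ℝ g x‖ₑ ^ 2) := by
  have hm : AEMeasurable (fun x => ‖g x‖ₑ) volume := hg.continuous.measurable.enorm.aemeasurable
  refine (lintegral_rpow_tenThirds_le_Lp_interpolation volume hm).trans (mul_le_mul' le_rfl ?_)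
  calc (∫⁻ x, ‖g x‖ₑ ^ (6 : ℝ)) ^ (1 / 3 : ℝ)
      ≤ ((eLpNormLESNormFDerivOfEqInnerConst (volume : Measure (EuclideanSpace ℝ (Fin 3))) 2 : ℝ≥0∞)
          ^ (6 : ℝ) * (∫⁻ x, ‖fderiv ℝ g x‖ₑ ^ 2) ^ (3 : ℝ)) ^ (1 / 3 : ℝ) :=
        ENNReal.rpow_le_rpow (lintegral_enorm_rpow_six_le hg hgc) (by norm_num)
    _ = _ := by
        rw [ENNReal.mul_rpow_of_nonneg _ _ (by norm_num), ← ENNReal.rpow_mul, ← ENNReal.rpow_mul,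
          show (6 : ℝ) * (1 / 3) = 2 by norm_num, show (3 : ℝ) * (1 / 3) = 1 by norm_num,
          ENNReal.rpow_one]

/-- **The space–time `L^{10/3}` bound from (2.7)** (Seregin: "`|f|²_{2,Q} = sup_t ‖f(·,t)‖²_{2,𝒞}
+ ‖∇f‖²_{2,Q}`", here for `f = ζΦ`, giving the finiteness of `‖Φη³‖_{10/3,Q}` used in the `v_θ`
passage): for a `C¹` compactly supported `ζ` and `C¹` slices `Φ t`, `t ∈ ]t₁, 0[`, with
`sup_t ∫ (ζΦ)² ≤ K` and `∫_{t₁}^0 ∫ ‖D(ζΦ)‖² ≤ K'`: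
`∫_{t₁}^0 ∫ |ζΦ|^{10/3} ≤ K^{2/3} C_S² K'`. [cite: Seregin2022LocalAxisym, §2 Step 4 (arXiv:2201.00153 p. 7), (2.7)] -/
theorem lintegral_lintegral_enorm_mul_rpow_tenThirds_le' {Φ : ℝ → EuclideanSpace ℝ (Fin 3) → ℝ}
    {t₁ : ℝ} {K K' : ℝ≥0} (hζ : ContDiff ℝ 1 ζ) (hζc : HasCompactSupport ζ)
    (hΦ : ∀ t ∈ Ioo t₁ 0, ContDiff ℝ 1 (Φ t))
    (h2 : ∀ t ∈ Ioo t₁ 0, ∫⁻ x, ‖ζ x * Φ t x‖ₑ ^ 2 ≤ K)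
    (hD : ∫⁻ t in Ioo t₁ 0, ∫⁻ x, ‖fderiv ℝ (fun y => ζ y * Φ t y) x‖ₑ ^ 2 ≤ K') :
    ∫⁻ t in Ioo t₁ 0, ∫⁻ x, ‖ζ x * Φ t x‖ₑ ^ (10 / 3 : ℝ) ≤
      (K : ℝ≥0∞) ^ (2 / 3 : ℝ) *
        ((eLpNormLESNormFDerivOfEqInnerConst (volume : Measure (EuclideanSpace ℝ (Fin 3))) 2 : ℝ≥0∞)
          ^ (2 : ℝ) * K') := by
  set CS : ℝ≥0∞ := (eLpNormLESNormFDerivOfEqInnerConst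
    (volume : Measure (EuclideanSpace ℝ (Fin 3))) 2 : ℝ≥0∞) with hCS
  have hKt : (K : ℝ≥0∞) ^ (2 / 3 : ℝ) ≠ ∞ := ENNReal.rpow_ne_top_of_nonneg (by norm_num) ENNReal.coe_ne_top
  have hCSt : CS ^ (2 : ℝ) ≠ ∞ := ENNReal.rpow_ne_top_of_nonneg (by norm_num) ENNReal.coe_ne_top
  have hslice : ∀ t ∈ Ioo t₁ 0, ∫⁻ x, ‖ζ x * Φ t x‖ₑ ^ (10 / 3 : ℝ) ≤
      (K : ℝ≥0∞) ^ (2 / 3 : ℝ) * (CS ^ (2 : ℝ) * ∫⁻ x, ‖fderiv ℝ (fun y => ζ y * Φ t y) x‖ₑ ^ 2) := by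
    intro t ht
    refine (lintegral_enorm_rpow_tenThirds_le_of_contDiff (hζ.mul (hΦ t ht)) hζc.mul_right).trans ?_
    gcongr
    exact h2 t ht
  calc ∫⁻ t in Ioo t₁ 0, ∫⁻ x, ‖ζ x * Φ t x‖ₑ ^ (10 / 3 : ℝ)
      ≤ ∫⁻ t in Ioo t₁ 0, (K : ℝ≥0∞) ^ (2 / 3 : ℝ) *
          (CS ^ (2 : ℝ) * ∫⁻ x, ‖fderiv ℝ (fun y => ζ y * Φ t y) x‖ₑ ^ 2) :=
        setLIntegral_mono' measurableSet_Ioo hslice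
    _ = (K : ℝ≥0∞) ^ (2 / 3 : ℝ) * (CS ^ (2 : ℝ) *
          ∫⁻ t in Ioo t₁ 0, ∫⁻ x, ‖fderiv ℝ (fun y => ζ y * Φ t y) x‖ₑ ^ 2) := by
        rw [lintegral_const_mul' _ _ hKt, lintegral_const_mul' _ _ hCSt]
    _ ≤ _ := by gcongr

/-- **The space–time `L^{10/3}` bound from (2.7)** (registered form of
`lintegral_lintegral_enorm_mul_rpow_tenThirds_le'`): for a `C¹` compactly supported cut-off `ζ`
and `C¹` slices `Φ t`, `t ∈ ]t₁, 0[`, with `sup_t ∫(ζΦ)² ≤ K` and `∫_{t₁}^0∫‖D(ζΦ)‖² ≤ K'`: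
`∫_{t₁}^0 ∫ |ζΦ|^{10/3} ≤ K^{2/3} C_S² K'` — the finiteness of Seregin's `‖Φη³‖_{10/3,Q}`.
[cite: Seregin2022LocalAxisym, §2 Step 4 (arXiv:2201.00153 p. 7), (2.7)] -/
theorem lintegral_lintegral_enorm_mul_rpow_tenThirds_le : ∀ (ζ : EuclideanSpace ℝ (Fin 3) → ℝ) (Φ : ℝ → EuclideanSpace ℝ (Fin 3) → ℝ) (t₁ : ℝ) (K K' : ℝ≥0), ContDiff ℝ 1 ζ → HasCompactSupport ζ → (∀ t ∈ Ioo t₁ 0, ContDiff ℝ 1 (Φ t)) → (∀ t ∈ Ioo t₁ 0, ∫⁻ x, ‖ζ x * Φ t x‖ₑ ^ 2 ≤ K) → (∫⁻ t in Ioo t₁ 0, ∫⁻ x, ‖fderiv ℝ (fun y => ζ y * Φ t y) x‖ₑ ^ 2 ≤ K') → ∫⁻ t in Ioo t₁ 0, ∫⁻ x, ‖ζ x * Φ t x‖ₑ ^ (10 / 3 : ℝ) ≤ (K : ℝ≥0∞) ^ (2 / 3 : ℝ) * (((eLpNormLESNormFDerivOfEqInnerConst (volume : Measure (EuclideanSpace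 ℝ (Fin 3))) 2 : ℝ≥0∞) ^ (2 : ℝ)) * K') :=
  fun _ _ _ _ _ hζ hζc hΦ h2 hD => lintegral_lintegral_enorm_mul_rpow_tenThirds_le' hζ hζc hΦ h2 hD

end Phi

end Summit.NavierStokesRegularity.NavierStokesRegularity.Theorems.AxisymmetricKatoGlobal.EulerScaling

end
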